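import Summits.Langlands.Langlands.Theses.SqrtFiveQuarticCovers
import Literature.NumberTheory.Automorphic.TotallyRealModularitySmallImage
import Literature.NumberTheory.Automorphic.TotallyRealModularityProofs
import HarnessLib

/-!
# Route `SqrtFiveQuarticCovers` — the residual `SectorComplement` (stmt-Langlands-2175):
# logical position, and the route's `Target` from its two cruxes plus Box's two printed theorems

`Summit.Langlands.Langlands.Theses.SqrtFiveQuarticCovers.SectorComplement := Target → Langlands`
is the route's DECLARED RESIDUAL ("the rest of the summit": direction (A), every other `(n, F)`,
local–global compatibility, the data `𝓡`; conjecture-grade, never staffed from this route — route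
file docstring).  This `--supports` file proves NO part of it.  It records, kernel-checked and
without defining any proposition:

* `target_of_cruxes_of_Box2022` — the route's `Target` (every elliptic curve over every totally
  real quartic field is modular, in the summit's written-out cone) from the two cruxes
  `RefinedLocusModular` (stmt-Langlands-17833, the F-L1 census crux) and `ReductionToRefinedLocus`
  (stmt-Langlands-17834) together with Box's two PRINTED theorems as named Literature facts,
  `Box2022_theorem1_5_modular` (Thm. 1.5 + 1.4) and `Box2022_theorem1_1` (Thm. 1.1) — i.e. the
  route's deciding theorem `closes` with the residual `SectorComplement` removed and the binders
  `BoxBorelFive`, `BoxQuartic` supplied by the landed conditional theorems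
  `BoxBorelFive_of_Box2022_theorem1_5_modular` (p647780), `BoxQuartic_of_Box2022_theorem1_1`
  (p647856) — re-derived here in three lines each from the Literature bridges so that this file
  imports no other `Theorems` module (theses-cone hygiene).  `target_of_items` is the same with the
  four items as hypotheses (pure glue).
* `not_sectorComplement_iff` — refutability criterion `¬ SectorComplement ↔ Target ∧ ¬ Langlands`:
  a disproof of the residual is a PROOF of the target together with a refutation of the summit as
  typed; `sectorComplement_iff_langlands_of_cruxes_of_Box2022` — under the two cruxes and Box's two
  theorems the residual is literally equivalent to `Langlands`.  (The generic frame-item lemmas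
  "summit ⇒ residual", "under `Target` the residual is the summit", "¬ residual ⇒ ¬ summit" are
  already landed for the homonymous items of other routes and are not restated.)

HONEST STATUS (cell lg-quartmod, rung F-L1): nothing here proves modularity of a new class of
elliptic curves, and nothing here proves any part of `SectorComplement`; the content is WHERE the
route's open mathematics lives — in `RefinedLocusModular` (the eight refined curves' quadratic
points over `ℚ(√5)`) and `ReductionToRefinedLocus` (modulo FLS Thms. 3–4, Kalyanswamy Thm. 1.2 and
the census `GroupCensusFive`) — with Box's Thm. 1.1 / Thm. 1.5 cited, not proved.

References: [Box2022] J. Box, Trans. AMS 375 (2022) = arXiv:2103.13975, Thm. 1.1, Thms. 1.4–1.5,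
§7.1; [BuzzardGeeLMS2014] Conj. 3.2.1–3.2.2; [FontaineMazurGeometric1995] Conj. 1.
-/

noncomputable section

set_option linter.dupNamespace false -- project-wide option; `Summit.Langlands.Langlands` is the mandated namespace

open NumberField
open Literature.NumberTheory.Automorphic
open Summit.Langlands.Langlands.Theses.SqrtFiveQuarticCovers

namespace Summit.Langlands.Langlands.Theorems.SqrtFiveQuarticCovers

/-! ## 1. The route's `Target` without the residual -/

/-- **`Target` from the four non-residual items (pure glue).**  `RefinedLocusModular`,
`ReductionToRefinedLocus`, `BoxBorelFive`, `BoxQuartic` imply the route's `Target`: every elliptic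
curve (`Δ ≠ 0` model) over every totally real quartic field is modular in the summit's
written-out cone.  This is the body of the route's `closes` with `SectorComplement` removed: split
on `√5 ∈ K`; if so, argue by contradiction through the reduction and the two `v5`-branches; if
not, Box's Thm. 1.1.  [cite: Box2022, Thm. 1.1 and §7.1] -/
theorem target_of_items (h₂ : RefinedLocusModular) (h₃ : ReductionToRefinedLocus)
    (h₄ : BoxBorelFive) (hB : BoxQuartic) : Target := by
  intro K _ _ hK hdeg E hE
  by_cases h5 : ∃ r : K, r ^ 2 = 5
  · by_contra hne
    obtain ⟨h3s, h5s, h7s⟩ := h₃ K hK hdeg h5 E hE hne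
    rcases h5s with hb | hh
    · exact hne (h₄ K hK hdeg h5 E hE h3s hb h7s)
    · exact hne (h₂ K hK hdeg h5 E hE h3s hh h7s)
  · exact hB K hK hdeg h5 E hE

/-- **`Target` from the two cruxes and Box's two printed theorems.**  Under the named Literature
facts `Box2022_theorem1_5_modular` (Box 2022 Thm. 1.5 with Thm. 1.4: the four `b5`-curves) and
`Box2022_theorem1_1` (Box 2022 Thm. 1.1: quartic `K ∌ √5`), the cruxes `RefinedLocusModular` and
`ReductionToRefinedLocus` give the route's `Target`.  CONDITIONAL on the two named facts (published
theorems, cited not proved); the two branches are the proofs of the landed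
`BoxBorelFive_of_Box2022_theorem1_5_modular` / `BoxQuartic_of_Box2022_theorem1_1`, inlined
(Literature bridges `Box2022_theorem1_5_modular.isHilbertModular`,
`IsHilbertModular.isModularEllipticCurve`, `Box2022_theorem1_1.isModularEllipticCurve`).
[cite: Box2022, Thm. 1.1, Thm. 1.5, Thm. 1.4] -/
theorem target_of_cruxes_of_Box2022 (h₂ : RefinedLocusModular) (h₃ : ReductionToRefinedLocus)
    (h15 : Box2022_theorem1_5_modular) (h11 : Box2022_theorem1_1) : Target := by
  refine target_of_items h₂ h₃ ?_ ?_
  · intro K _ _ hK hd _ E hE h3 hb5 h7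
    haveI : IsTotallyReal K := hK
    exact (Box2022_theorem1_5_modular.isHilbertModular h15 K hd hE h3 hb5 h7).isModularEllipticCurve
  · intro K _ _ hK hd h5 E hE
    haveI : IsTotallyReal K := hK
    refine Box2022_theorem1_1.isModularEllipticCurve h11 K hd ?_ hE
    rintro ⟨r, hr⟩
    exact h5 ⟨r, by rw [sq]; exact hr.symm⟩

/-! ## 2. Logical position of the residual `SectorComplement := Target → Langlands` -/

/-- **Refutability criterion.**  `¬ SectorComplement ↔ Target ∧ ¬ Langlands`: refuting the
residual means PROVING the route's target and REFUTING the summit as typed. [folklore] -/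
theorem not_sectorComplement_iff : ¬ SectorComplement ↔ (Target ∧ ¬ _root_.Langlands) :=
  Classical.not_imp

/-- Under the two cruxes and Box's two printed theorems (named facts) the residual
`SectorComplement` is equivalent to the summit `Langlands` — it carries no mathematics of this
route.  [cite: Box2022, Thm. 1.1, Thm. 1.5] -/
theorem sectorComplement_iff_langlands_of_cruxes_of_Box2022 (h₂ : RefinedLocusModular)
    (h₃ : ReductionToRefinedLocus) (h15 : Box2022_theorem1_5_modular)
    (h11 : Box2022_theorem1_1) : SectorComplement ↔ _root_.Langlands :=
  ⟨fun h => h (target_of_cruxes_of_Box2022 h₂ h₃ h15 h11), fun hL _ => hL⟩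

end Summit.Langlands.Langlands.Theorems.SqrtFiveQuarticCovers

end
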